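import Summits.ResolutionOfSingularities.ResolutionOfSingularities.Theorems.EquisingularLiftEquisingularLiftNatTowerCurveStepBSZeroAt
import Summits.ResolutionOfSingularities.ResolutionOfSingularities.Theorems.EquisingularLiftEquisingularLiftNatTowerCurveStepPlane
import Summits.ResolutionOfSingularities.ResolutionOfSingularities.Theorems.EquisingularLiftEquisingularLiftNatTowerCurveStepBSZero
import HarnessLib

/-!
# [OURS · L1 W4.5(b) · EL♮(3) · T23-A‴ (U6), SHADOW-FREE ARM] THE SHADOW-FREE CURVE STEP WITH PLANES: `Tower.invB₄_of_invS₀L_curveStep_forget` / `…_FE` —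
# `TCPlus.InvS₀L … W F₉ β₉ T₉ Z₉ S₉ Ls₉ b₉` (no cone, `K₉ = ∅`) and the model-less planes `Ms₉` ⟹ `Tower.InvB₄ … F₁₀ (𝟙 F₁₀) (St T₉) (υ'⁻¹Z₉) Es₁₀ Ns₁₀ (St ∅)`
# for every round seed allowed by res-L1-w45b-lead-2's (D‴6) guard 0c6a341d172f5c17; the twin of …NatTowerCurveStepBSL p629286 (res-L1-w45b-stub-4's
# request 2026-08-28T11:24:07Z, interface `hCurve` of V10⁗ p629217 in the `K₂ = ∅` arm)

res-type-027 g18 ((U6) owner), brick (G6c). OURS; NOT a statement of any manuscript ([Hironaka2017] is a candidate under adjudication, nothing of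
it is asserted); AI-written, weaker than expert review. No `sorry`; standard axioms; DEF-FREE; `--supports stmt-ResolutionOfSingularities-20148 --as helper`.
ASSEMBLY of `Tower.stageB₄_of_memberS₀At_curveStep` (G6a p630303) and `Tower.exc₄_plane_curveStep` (F6b p629016) + res-L1-w45b-stub-2's `Tower.ns_transport`.
[cite: GortzWedhorn2020, Prop. 13.91 and (13.19)] [cite: Liu2002, Thm. 8.1.19] [cite: Matsumura1987, Thm. 14.2] [cite: StacksProject, Tag 01WS]
-/

set_option linter.dupNamespace false -- mandated namespace `Summit.<Summit>.<Problem>` of this single-conjunct summit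
set_option linter.overlappingInstances false -- signatures carry `[IsDomain O] [IsDiscreteValuationRing O]`

noncomputable section

open CategoryTheory CategoryTheory.Limits AlgebraicGeometry TopologicalSpace Topology IsLocalRing
open Literature.AlgebraicGeometry.Resolution
open AlgebraicGeometry.Scheme.IdealSheafData
open Summit.ResolutionOfSingularities.ResolutionOfSingularities.Theses.EquisingularLift.Split
open Summit.ResolutionOfSingularities.ResolutionOfSingularities.Cruxes.EquisingularLift.StrataSplit

namespace Summit.ResolutionOfSingularities.ResolutionOfSingularities.Cruxes.EquisingularLiftNat.Sections

set_option maxHeartbeats 800000 in -- one large refine over a 20-clause invariant (as the KCL brick)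
/-- **The shadow-free curve step with planes, generic `Ruled` with three stand-ins** (see the module docstring). [cite: GortzWedhorn2020, Prop. 13.91 and (13.19)]
[cite: Liu2002, Thm. 8.1.19] [OURS · L1 W4.5b · T23-A‴ (U6)] brick (G6c) (stmt-ResolutionOfSingularities-20148); NOT a statement of the manuscript. -/
theorem Tower.invB₄_of_invS₀L_curveStep_forget (O : Type) [CommRing O] [IsDomain O] [IsDiscreteValuationRing O] (k : Type) [Field k]
    (θ : O →+* k) (hθ : Function.Surjective θ)
    (P : Scheme.{0}) (q : P ⟶ Spec (.of O)) [IsProper q] (Y : Set P) (hYsp : Y ⊆ q ⁻¹' {closedPoint O})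
    (hYirr : IsIrreducible Y) (hYcl : IsClosed Y)
    (hPnoeth : IsLocallyNoetherian P) (hPreg : Scheme.IsRegular P)
    (Ch : ∀ X' : Scheme.{0}, (X' ⟶ P) → Set X' → Prop)
    (hChain : ∀ (X' : Scheme.{0}) (σ : X' ⟶ P) (S : Set X'), Ch X' σ S → Chain P Y X' σ S)
    (hStep : ∀ (X' X'' : Scheme.{0}) (σ' : X' ⟶ P) (S' : Set X') (C : X'.IdealSheafData) (τ : X'' ⟶ X'),
      Ch X' σ' S' → IsBlowup τ C → Scheme.IsRegular C.subscheme → Flat (C.subschemeι ≫ σ' ≫ q) →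
      σ' '' (C.support : Set X') ⊆ {x : P | ¬ IsGenericPoint x Y} →
      (C.support : Set X') ∩ (σ' ≫ q) ⁻¹' {IsLocalRing.closedPoint O} ⊆ S' →
      Ch X'' (τ ≫ σ') (closure (τ ⁻¹' (S' \ (C.support : Set X')))))
    (Ruled : Tower.RuledDatum P)
    {F₁ F₂ : Scheme.{0}} (W : Set F₁) (F₉ : Scheme.{0}) (β₉ : F₉ ⟶ F₂) (T₉ Z₉ K₉ S₉ : Set F₉) (Ls₉ Ms₉ : List (Set F₉)) (b₉ : Bool)
    (hZ₉ : IsClosed Z₉) (F₁₀ : Scheme.{0}) (υ' : F₁₀ ⟶ F₉)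
    (hI : TCPlus.InvS₀L O k θ P q Y Ch W F₉ β₉ T₉ Z₉ S₉ Ls₉ b₉)
    -- downstairs bookkeeping of the planes (model-carrying `Ls₉` = `Ps₉`, model-less `Ms₉`): closed, not containing the running curve
    (hLs : ∀ L ∈ Ls₉, IsClosed L ∧ ¬ T₉ ⊆ L) (hMs : ∀ M ∈ Ms₉, IsClosed M ∧ ¬ T₉ ⊆ M)
    (hZinf : Z₉.Infinite) (hK₉ : K₉ = ∅)
    -- downstairs side facts of the plane: closed, `Z₉` nowhere dense in it, not containing the running curve
    (hScl : IsClosed S₉) (hSdense : S₉ ⊆ closure (S₉ \ Z₉)) (hTS₉ : ¬ T₉ ⊆ S₉)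
    (hZT : Z₉ ⊆ T₉) (hTZ : ¬ T₉ ⊆ Z₉) (hυ' : IsBlowup υ' (vanishingIdeal ⟨Z₉, hZ₉⟩))
    -- STAND-IN (owner res-L1-w45b-stub-2 / res-type-027): the ruled-surface datum of the new exceptional surface, root = this step
    (hRuled : ∀ (X : Scheme.{0}) (σ : X ⟶ P) (S : Set X) (jG : F₉ ⟶ X) (tG : F₉ ⟶ Spec (.of k)) (𝓢 K : X.IdealSheafData)
        (X₁₀ : Scheme.{0}) (τ : X₁₀ ⟶ X) (j₁₀ : F₁₀ ⟶ X₁₀) (t₁₀ : F₁₀ ⟶ Spec (.of k)),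
        Ch X σ S → IsIntegral X → IsLocallyNoetherian X → Scheme.IsRegular X → IsDominant (σ ≫ q) →
        IsPullback jG tG (σ ≫ q) (Spec.map (CommRingCat.ofHom θ)) → jG '' T₉ = S →
        (𝓢 ⊔ K).comap jG = vanishingIdeal ⟨Z₉, hZ₉⟩ → Flat ((𝓢 ⊔ K).subschemeι ≫ σ ≫ q) → Scheme.IsRegular (𝓢 ⊔ K).subscheme →
        Scheme.IsRegular 𝓢.subscheme → IsBlowup τ (𝓢 ⊔ K) → IsPullback j₁₀ t₁₀ ((τ ≫ σ) ≫ q) (Spec.map (CommRingCat.ofHom θ)) →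
        j₁₀ ≫ τ = υ' ≫ jG →
        Ruled F₉ Z₉ hZ₉ F₁₀ υ' F₁₀ (𝟙 F₁₀) (υ' ⁻¹' Z₉) X₁₀ (τ ≫ σ) j₁₀ ((𝓢 ⊔ K).comap τ))
    -- STAND-IN (S): the ruled-surface datum of the SEEDED MEMBER `St S₉`, model `St_{𝓢 ⊔ K} 𝓢` (at `FE`: T-STFLAT-GEN, see `…_FE` below)
    (hRuledS : ∀ (X : Scheme.{0}) (σ : X ⟶ P) (S : Set X) (jG : F₉ ⟶ X) (tG : F₉ ⟶ Spec (.of k)) (𝓢 K : X.IdealSheafData)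
        (X₁₀ : Scheme.{0}) (τ : X₁₀ ⟶ X) (j₁₀ : F₁₀ ⟶ X₁₀) (t₁₀ : F₁₀ ⟶ Spec (.of k)),
        Ch X σ S → IsIntegral X → IsLocallyNoetherian X → Scheme.IsRegular X → IsDominant (σ ≫ q) →
        IsPullback jG tG (σ ≫ q) (Spec.map (CommRingCat.ofHom θ)) → jG '' T₉ = S →
        (𝓢 ⊔ K).comap jG = vanishingIdeal ⟨Z₉, hZ₉⟩ → Flat ((𝓢 ⊔ K).subschemeι ≫ σ ≫ q) → Scheme.IsRegular (𝓢 ⊔ K).subscheme →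
        Scheme.IsRegular 𝓢.subscheme → IsBlowup τ (𝓢 ⊔ K) → IsPullback j₁₀ t₁₀ ((τ ≫ σ) ≫ q) (Spec.map (CommRingCat.ofHom θ)) →
        j₁₀ ≫ τ = υ' ≫ jG →
        𝓢.comap jG = vanishingIdeal ⟨closure S₉, isClosed_closure⟩ → Flat (𝓢.subschemeι ≫ σ ≫ q) →
        Ruled F₉ Z₉ hZ₉ F₁₀ υ' F₁₀ (𝟙 F₁₀) (closure (υ' ⁻¹' (S₉ \ Z₉))) X₁₀ (τ ≫ σ) j₁₀ (strictTransformIdeal τ (𝓢 ⊔ K) 𝓢))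
    -- STAND-IN (P): the ruled-surface datum of a TRANSPORTED PLANE, model `St_{𝓢 ⊔ K} 𝓛` (at `FE`: T-STFLAT-GEN)
    (hRuledP : ∀ (X : Scheme.{0}) (σ : X ⟶ P) (jG : F₉ ⟶ X) (𝓢 K : X.IdealSheafData) (X₁₀ : Scheme.{0}) (τ : X₁₀ ⟶ X) (j₁₀ : F₁₀ ⟶ X₁₀)
        (F' : Set F₁₀) (𝓕 : X.IdealSheafData), IsLocallyNoetherian X → IsLocallyNoetherian X₁₀ → IsBlowup τ (𝓢 ⊔ K) →
        Flat (𝓕.subschemeι ≫ σ ≫ q) → Ruled F₉ Z₉ hZ₉ F₁₀ υ' F₁₀ (𝟙 F₁₀) F' X₁₀ (τ ≫ σ) j₁₀ (strictTransformIdeal τ (𝓢 ⊔ K) 𝓕))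
    -- THE ROUND SEED (res-L1-w45b-lead-2's (D‴6) guard VERBATIM, `Ps₉ := Ls₉`)
    (Es₁₀ Ns₁₀ : List (Set F₁₀))
    (hEs : ∀ F ∈ Es₁₀, F = closure (υ' ⁻¹' (S₉ \ Z₉)) ∨
      ∃ Pl ∈ Ls₉, ∃ hP : IsClosed Pl,
        (∀ g ∈ Z₉ ∩ Pl, stalkIdeal (vanishingIdeal (⟨Z₉, hZ₉⟩ : Closeds F₉)) g ⊔ stalkIdeal (vanishingIdeal (⟨Pl, hP⟩ : Closeds F₉)) g =
            maximalIdeal (F₉.presheaf.stalk g)) ∧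
        (∀ g ∈ Z₉ ∩ Pl, stalkIdeal (vanishingIdeal (⟨Z₉, hZ₉⟩ : Closeds F₉)) g ≠ maximalIdeal (F₉.presheaf.stalk g)) ∧
        F = closure (υ' ⁻¹' (Pl \ Z₉)))
    (hNs : ∀ F ∈ Ns₁₀, ∃ Pl ∈ Ls₉ ++ Ms₉, F = closure (υ' ⁻¹' (Pl \ Z₉))) :
    Tower.InvB₄ O k θ P q Y Ch Ruled F₉ Z₉ hZ₉ F₁₀ υ' F₁₀ (𝟙 F₁₀) (closure (υ' ⁻¹' (T₉ \ Z₉))) (υ' ⁻¹' Z₉) Es₁₀ Ns₁₀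
      (closure (υ' ⁻¹' (K₉ \ Z₉))) := by
  classical
  obtain ⟨hGint, -, hT₉irr, -, hmemL, -⟩ := hI
  obtain ⟨X, σ, S, jG, tG, 𝓢, K, hmem, hLdata⟩ := hmemL
  haveI := hGint
  obtain ⟨X₂, τ, j₂, t₂, hτ, hcomm, hsq₂, hCD, hCreg, hCne, hF₂, hirr, hTE, hTS₁₀, hCh₂, hint₂, hnoeth₂, hreg₂, hdom₂, hEdat, hSdat⟩ :=
    Tower.stageB₄_of_memberS₀At_curveStep O k θ hθ P q Y hYsp hYirr hYcl hPnoeth hPreg Ch hChain hStep Ruled F₉ T₉ Z₉ K₉ S₉ hZ₉ hT₉irr F₁₀ υ'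
      X σ S jG tG 𝓢 K hmem hZinf hK₉ hScl hSdense hTS₉ hZT hTZ hυ' hRuled hRuledS
  obtain ⟨hCh, hXint, hXnoeth, hXreg, -, hsq, -, -, hii, -, -, -, -, -, -, -, -⟩ := hmem
  haveI := hXint
  haveI := hXnoeth
  haveI := hint₂
  haveI := hnoeth₂
  obtain ⟨-, -, hσ⟩ := chain_isRegular P Y X σ S (hChain _ _ _ hCh) hPnoeth hPreg
  haveI := hσ
  haveI : IsProper (σ ≫ q) := inferInstance
  haveI : IsClosedImmersion (Spec.map (CommRingCat.ofHom θ)) := IsClosedImmersion.spec_of_surjective _ hθ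
  haveI hjci : IsClosedImmersion jG := MorphismProperty.IsStableUnderBaseChange.of_isPullback hsq.flip inferInstance
  haveI : IsLocallyNoetherian F₉ := LocallyOfFiniteType.isLocallyNoetherian jG
  have hsuppZ : ((vanishingIdeal ⟨Z₉, hZ₉⟩ : F₉.IdealSheafData).support : Set F₉) ⊆ Z₉ :=
    (Scheme.IdealSheafData.coe_support_vanishingIdeal _).le
  -- the plane block (F6b), in the SAME stage
  have hplane : ∀ Pl ∈ Ls₉, ∀ hP : IsClosed Pl,
      (∀ g ∈ Z₉ ∩ Pl, stalkIdeal (vanishingIdeal (⟨Z₉, hZ₉⟩ : Closeds F₉)) g ⊔ stalkIdeal (vanishingIdeal (⟨Pl, hP⟩ : Closeds F₉)) g =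
          maximalIdeal (F₉.presheaf.stalk g)) →
      (∀ g ∈ Z₉ ∩ Pl, stalkIdeal (vanishingIdeal (⟨Z₉, hZ₉⟩ : Closeds F₉)) g ≠ maximalIdeal (F₉.presheaf.stalk g)) →
      (IsClosed (closure (υ' ⁻¹' (Pl \ Z₉))) ∧ ¬ closure (υ' ⁻¹' (T₉ \ Z₉)) ⊆ closure (υ' ⁻¹' (Pl \ Z₉))) ∧
        ∀ hF' : IsClosed (closure (υ' ⁻¹' (Pl \ Z₉))),
          Tower.Exc₄ O P q Y Ruled Z₉ hZ₉ υ' F₁₀ (𝟙 F₁₀) (closure (υ' ⁻¹' (Pl \ Z₉))) hF' ∅ X₂ (τ ≫ σ) j₂ :=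
    fun Pl hPlmem hP hT1 hT2 =>
      Tower.exc₄_plane_curveStep O hθ P q Y Ruled hυ' hXreg hsq hCD hCreg hii hCne hτ hsq₂ hcomm
        (fun F' 𝓕 h => hRuledP X σ jG 𝓢 K X₂ τ j₂ F' 𝓕 hXnoeth hnoeth₂ hτ h) hT₉irr hTZ hP (hLdata Pl hPlmem) (hLs Pl hPlmem).2 hT1 hT2
  refine ⟨hυ', hZinf, hF₂, isClosed_closure, hirr, hZ₉.preimage υ'.continuous, hTE, ?_, ?_, X₂, τ ≫ σ, _, j₂, t₂, hCh₂, hint₂, hnoeth₂,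
    hreg₂, hdom₂, hsq₂, rfl, hEdat, ?_⟩
  · -- `Es₁₀`: closed, not containing the new running curve
    intro F hF
    rcases hEs F hF with rfl | ⟨Pl, hPlmem, hP, hT1, hT2, rfl⟩
    · exact ⟨isClosed_closure, hTS₁₀⟩
    · exact (hplane Pl hPlmem hP hT1 hT2).1
  · -- `Ns₁₀`: topology only
    exact Tower.ns_transport hυ' hT₉irr hZ₉ hTZ hsuppZ
      (fun F hF => by
        rcases List.mem_append.mp hF with h | h
        · exact hLs F h
        · exact hMs F h) hNs
  · -- `Es₁₀`: the member data `Exc₄ … F hF ∅` in the SAME stage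
    intro F hF hFcl
    rcases hEs F hF with rfl | ⟨Pl, hPlmem, hP, hT1, hT2, rfl⟩
    · exact hSdat hFcl
    · exact (hplane Pl hPlmem hP hT1 hT2).2 hFcl

/-! ## At `Ruled := FE`: the three stand-ins discharged -/

/-- **THE SHADOW-FREE CURVE STEP `TCPlus.InvS₀L ⇒ Tower.InvB₄ … Es₁₀ Ns₁₀ …` AT `FE := Flat (𝓔.subschemeι ≫ σ ≫ q)`, NO STAND-IN** (`hRuled` by
`flat_exceptional_of_isBlowup_regularCentre`, `hRuledS`/`hRuledP` by T-STFLAT-GEN `flat_strictTransform_subschemeι_comp_stage`).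
[OURS · L1 W4.5b · T23-A‴ (U6)] brick (G6c) (stmt-ResolutionOfSingularities-20148); NOT a statement of the manuscript. -/
theorem Tower.invB₄_of_invS₀L_curveStep_forget_FE (O : Type) [CommRing O] [IsDomain O] [IsDiscreteValuationRing O] (k : Type) [Field k]
    (θ : O →+* k) (hθ : Function.Surjective θ)
    (P : Scheme.{0}) (q : P ⟶ Spec (.of O)) [IsProper q] (Y : Set P) (hYsp : Y ⊆ q ⁻¹' {closedPoint O})
    (hYirr : IsIrreducible Y) (hYcl : IsClosed Y)
    (hPnoeth : IsLocallyNoetherian P) (hPreg : Scheme.IsRegular P)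
    (Ch : ∀ X' : Scheme.{0}, (X' ⟶ P) → Set X' → Prop)
    (hChain : ∀ (X' : Scheme.{0}) (σ : X' ⟶ P) (S : Set X'), Ch X' σ S → Chain P Y X' σ S)
    (hStep : ∀ (X' X'' : Scheme.{0}) (σ' : X' ⟶ P) (S' : Set X') (C : X'.IdealSheafData) (τ : X'' ⟶ X'),
      Ch X' σ' S' → IsBlowup τ C → Scheme.IsRegular C.subscheme → Flat (C.subschemeι ≫ σ' ≫ q) →
      σ' '' (C.support : Set X') ⊆ {x : P | ¬ IsGenericPoint x Y} →
      (C.support : Set X') ∩ (σ' ≫ q) ⁻¹' {IsLocalRing.closedPoint O} ⊆ S' →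
      Ch X'' (τ ≫ σ') (closure (τ ⁻¹' (S' \ (C.support : Set X')))))
    {F₁ F₂ : Scheme.{0}} (W : Set F₁) (F₉ : Scheme.{0}) (β₉ : F₉ ⟶ F₂) (T₉ Z₉ K₉ S₉ : Set F₉) (Ls₉ Ms₉ : List (Set F₉)) (b₉ : Bool)
    (hZ₉ : IsClosed Z₉) (F₁₀ : Scheme.{0}) (υ' : F₁₀ ⟶ F₉)
    (hI : TCPlus.InvS₀L O k θ P q Y Ch W F₉ β₉ T₉ Z₉ S₉ Ls₉ b₉)
    -- downstairs bookkeeping of the planes (model-carrying `Ls₉` = `Ps₉`, model-less `Ms₉`): closed, not containing the running curve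
    (hLs : ∀ L ∈ Ls₉, IsClosed L ∧ ¬ T₉ ⊆ L) (hMs : ∀ M ∈ Ms₉, IsClosed M ∧ ¬ T₉ ⊆ M)
    (hZinf : Z₉.Infinite) (hK₉ : K₉ = ∅)
    -- downstairs side facts of the plane: closed, `Z₉` nowhere dense in it, not containing the running curve
    (hScl : IsClosed S₉) (hSdense : S₉ ⊆ closure (S₉ \ Z₉)) (hTS₉ : ¬ T₉ ⊆ S₉)
    (hZT : Z₉ ⊆ T₉) (hTZ : ¬ T₉ ⊆ Z₉) (hυ' : IsBlowup υ' (vanishingIdeal ⟨Z₉, hZ₉⟩))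
    (Es₁₀ Ns₁₀ : List (Set F₁₀))
    (hEs : ∀ F ∈ Es₁₀, F = closure (υ' ⁻¹' (S₉ \ Z₉)) ∨
      ∃ Pl ∈ Ls₉, ∃ hP : IsClosed Pl,
        (∀ g ∈ Z₉ ∩ Pl, stalkIdeal (vanishingIdeal (⟨Z₉, hZ₉⟩ : Closeds F₉)) g ⊔ stalkIdeal (vanishingIdeal (⟨Pl, hP⟩ : Closeds F₉)) g =
            maximalIdeal (F₉.presheaf.stalk g)) ∧
        (∀ g ∈ Z₉ ∩ Pl, stalkIdeal (vanishingIdeal (⟨Z₉, hZ₉⟩ : Closeds F₉)) g ≠ maximalIdeal (F₉.presheaf.stalk g)) ∧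
        F = closure (υ' ⁻¹' (Pl \ Z₉)))
    (hNs : ∀ F ∈ Ns₁₀, ∃ Pl ∈ Ls₉ ++ Ms₉, F = closure (υ' ⁻¹' (Pl \ Z₉))) :
    Tower.InvB₄ O k θ P q Y Ch (fun _ _ _ _ _ _ _ _ _ σ _ 𝓔 => Flat (𝓔.subschemeι ≫ σ ≫ q)) F₉ Z₉ hZ₉ F₁₀ υ' F₁₀ (𝟙 F₁₀)
      (closure (υ' ⁻¹' (T₉ \ Z₉))) (υ' ⁻¹' Z₉) Es₁₀ Ns₁₀ (closure (υ' ⁻¹' (K₉ \ Z₉))) :=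
  Tower.invB₄_of_invS₀L_curveStep_forget O k θ hθ P q Y hYsp hYirr hYcl hPnoeth hPreg Ch hChain hStep _ W F₉ β₉ T₉ Z₉ K₉ S₉ Ls₉ Ms₉ b₉ hZ₉ F₁₀ υ'
    hI hLs hMs hZinf hK₉ hScl hSdense hTS₉ hZT hTZ hυ'
    (fun X σ S jG tG 𝓢 K X₁₀ τ j₁₀ t₁₀ _ _ hXnoeth hXreg _ _ _ _ hCflat hCreg _ hτ _ _ => by
      haveI := hXnoeth
      have h := flat_exceptional_of_isBlowup_regularCentre O X X₁₀ (σ ≫ q) (𝓢 ⊔ K) hXreg hCreg hCflat τ hτ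
      simpa only [Category.assoc] using h)
    (fun X σ S jG tG 𝓢 K X₁₀ τ j₁₀ t₁₀ _ _ hXnoeth _ _ _ _ _ _ _ _ hτ _ _ _ hSflat => by
      haveI := hXnoeth
      haveI : IsLocallyNoetherian X₁₀ := by
        haveI : IsProper τ := hτ.isProper
        exact LocallyOfFiniteType.isLocallyNoetherian τ
      exact flat_strictTransform_subschemeι_comp_stage O σ q τ (𝓢 ⊔ K) hτ 𝓢 hSflat)
    (fun X σ jG 𝓢 K X₁₀ τ j₁₀ F' 𝓕 hXnoeth hX₁₀noeth hτ h => by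
      haveI := hXnoeth
      haveI := hX₁₀noeth
      exact flat_strictTransform_subschemeι_comp_stage O σ q τ (𝓢 ⊔ K) hτ 𝓕 h)
    Es₁₀ Ns₁₀ hEs hNs

end Summit.ResolutionOfSingularities.ResolutionOfSingularities.Cruxes.EquisingularLiftNat.Sections

end
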